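import Mathlib
import HarnessLib
import Literature.Computability.Complexity.PNPWave0
import Literature.Computability.Complexity.TimeBounds
import Literature.Computability.Complexity.StackRoutines

/-!
# PneNP / OverlapGapAlgebra — `SearchHardWindow`, line `IdeaSketch_r2_k6`: the table stretch is polynomial time

Support for crux `stmt-PneNP-2460` (`Summit.PneNP.PneNP.Theses.OverlapGapAlgebra.SearchHardWindow`),
line `IdeaSketch_r2_k6` (exact self-couplings), stub `stub_stretchPolyTime`.

Along the variable-quotient coupling `v ↦ v / q` a solver's output table `y` (bit `v'` = value of
the quotient variable `v'`) has to be stretched to the block-constant table whose bit `v` is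
`y[v / q]`. The witness is the tree's `Com.repBits q y = y.flatMap (List.replicate q)` (every bit
repeated `q` times, `StackRoutines.lean`):

* `shwQS_getD_repBits` : `(repBits q y).getD v false = y.getD (v / q) false` for `q ≥ 1` and ALL
  `v` (inside the table this is block `v / q`; beyond `q · |y|` both sides are the default);
* `shwQS_repBits_mem_FP` : `repBits q ∈ FP`, by the two-loop structured stack program
  `pour 0 1 ;; loop 1 (pushN 2 true q) (pushN 2 false q)` over three registers (pour the input,
  reversed, onto register `1`; pop it bit by bit pushing each bit `q` times onto the output
  register `2`), of cost `(q + 5) |y| + 2`, compiled to Mathlib's `TM2` model by `Com.mem_FP`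
  (`StackPrograms.lean`); the loop's semantics is `shwQS_runs_emit` (the generic-register twin of
  `Com.runs_emitLoop`);
* `stub_stretchPolyTime` : the registered stub, `IsPolyTime` obtained from `FP` through
  `polyTimeComputable_iff_nonempty`.

No new definitions. Axioms: `propext`, `Classical.choice`, `Quot.sound`.
-/

-- `Summit.PneNP.PneNP.…` is the tree's mandated namespace (summit = sub-problem name).
set_option linter.dupNamespace false

namespace Summit.PneNP.PneNP.Theorems

open Literature.Computability.Complexity

/-! ### The stretch `repBits q` reads block `v / q` -/

/-- **Bit `v` of the stretched table is bit `v / q` of the table** (`q ≥ 1`), with the default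
`false` on both sides out of range. [folklore] -/
theorem shwQS_getD_repBits (q : ℕ) (hq : 0 < q) (y : List Bool) :
    ∀ v : ℕ, (Com.repBits q y).getD v false = y.getD (v / q) false := by
  induction y with
  | nil => intro v; simp
  | cons b y ih =>
    intro v
    rw [Com.repBits_cons]
    rcases Nat.lt_or_ge v q with hv | hv
    · rw [Nat.div_eq_of_lt hv, List.getD_append _ _ _ _ (by simpa using hv),
        List.getD_replicate _ hv, List.getD_cons_zero]
    · rw [List.getD_append_right _ _ _ _ (by simpa using hv), List.length_replicate, ih,
        Nat.div_eq_sub_div hq hv, List.getD_cons_succ]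

/-! ### The stretch is computed by a two-loop stack program -/

/-- **The emit loop** over any register type: `loop a (pushN b true q) (pushN b false q)` pops
register `a` bit by bit pushing each bit `q` times on `b ≠ a`, i.e. `a := []`,
`b := repBits q (reverse a) ++ b`, within `(q + 2)|a| + 1` steps (generic-register twin of
`Com.runs_emitLoop`). [folklore] -/
theorem shwQS_runs_emit {ι : Type} [DecidableEq ι] {a b : ι} (hab : a ≠ b) (q : ℕ)
    (w : List Bool) : ∀ R : Regs ι, R a = w →
      Com.Runs (Com.loop a (Com.pushN b true q) (Com.pushN b false q)) R
        (Function.update (Function.update R a []) b (Com.repBits q w.reverse ++ R b))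
        ((q + 2) * w.length + 1) := by
  induction w with
  | nil =>
    intro R h
    refine (Com.Runs.loop_nil _ _ h).of_eq ?_ (by simp)
    ext i : 1
    simp only [Function.update_apply, List.reverse_nil, Com.repBits_nil, List.nil_append]
    split_ifs <;> simp_all
  | cons c w ih =>
    intro R h
    have hstep : ∀ d : Bool, Com.Runs (Com.pushN b d q) (Function.update R a w)
        (Function.update (Function.update R a w) b (List.replicate q d ++ R b)) q := fun d => by
      simpa [Function.update_of_ne hab.symm] using Com.runs_pushN b d q (Function.update R a w)
    have hih : ∀ d : Bool, Com.Runs (Com.loop a (Com.pushN b true q) (Com.pushN b false q))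
        (Function.update (Function.update R a w) b (List.replicate q d ++ R b))
        (Function.update (Function.update R a []) b (Com.repBits q (d :: w).reverse ++ R b))
        ((q + 2) * w.length + 1) := by
      intro d
      refine (ih _ (by simp [Function.update_of_ne hab])).of_eq ?_ le_rfl
      ext i : 1
      simp only [Function.update_apply]
      split_ifs <;> simp_all
    cases c
    · exact (Com.Runs.loop_false h (hstep false) (hih false)).of_eq rfl (by simp; ring_nf; omega)
    · exact (Com.Runs.loop_true h (hstep true) (hih true)).of_eq rfl (by simp; ring_nf; omega)

/-- **The stretch `repBits q` is in `FP`**: the program `pour 0 1 ;; loop 1 (pushN 2 true q)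
(pushN 2 false q)` over `Fin 3` (input in `0`, output in `2`) computes it at cost
`(q + 5)|y| + 2` (`Com.mem_FP`). [folklore] -/
theorem shwQS_repBits_mem_FP (q : ℕ) : Com.repBits q ∈ FP := by
  refine Com.mem_FP (ι := Fin 3)
    (Com.pour 0 1 ;; Com.loop 1 (Com.pushN 2 true q) (Com.pushN 2 false q)) 0 2
    (Polynomial.C (q + 5) * Polynomial.X + Polynomial.C 2) _ fun z => ?_
  have h01 : (0 : Fin 3) ≠ 1 := by decide
  have h12 : (1 : Fin 3) ≠ 2 := by decide
  have h₁ := Com.runs_pour h01 (Regs.init (0 : Fin 3) z)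
  have hz : Regs.init (0 : Fin 3) z 0 = z := by simp [Regs.init]
  have h1e : Regs.init (0 : Fin 3) z 1 = [] := by simp [Regs.init]
  have h2e : Regs.init (0 : Fin 3) z 2 = [] := by simp [Regs.init]
  set R₁ := Function.update (Function.update (Regs.init (0 : Fin 3) z) 0 []) 1
    ((Regs.init (0 : Fin 3) z 0).reverse ++ Regs.init (0 : Fin 3) z 1) with hR₁
  have hR₁1 : R₁ 1 = z.reverse := by simp [hR₁, hz, h1e]
  have hR₁2 : R₁ 2 = [] := by simp [hR₁, h2e]
  have h₂ := shwQS_runs_emit h12 q z.reverse R₁ hR₁1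
  refine ⟨_, Or.inl ((h₁.seq h₂).mono ?_), ?_⟩
  · simp [hz]; ring_nf; omega
  · simp [hR₁2]

/-! ### The registered stub -/

/-- **The table stretch is polynomial time** (stub `stub_stretchPolyTime` of line
`IdeaSketch_r2_k6`, crux `stmt-PneNP-2460`): for every `q ≥ 1` there is a poly-time word function
`s` with `(s y)[v] = y[v / q]` (default `false`) for all `v`; witness `s = Com.repBits q`
(`y.flatMap (List.replicate q)`). [folklore] -/
theorem stub_stretchPolyTime (q : ℕ) (hq : 0 < q) :
    ∃ s : List Bool → List Bool, IsPolyTime s ∧ ∀ (y : List Bool) (v : ℕ),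
      (s y).getD v false = y.getD (v / q) false :=
  ⟨Com.repBits q, polyTimeComputable_iff_nonempty.1 (shwQS_repBits_mem_FP q),
    shwQS_getD_repBits q hq⟩

end Summit.PneNP.PneNP.Theorems
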